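import Summits.AtomisticToContinuum.HydrodynamicLimit.Theorems.SpeedCapSurgeryCappedEulerLimitRestrictedKl
import HarnessLib

/-!
# Crux `SpeedCapSurgery.CappedEulerLimit` (stmt-AtomisticToContinuum-17739), line `registered`, stub `restricted_windowEntropyBalance_identity`

THE ONE-WINDOW ENTROPY BALANCE FOR THE RESTRICTED LOCAL GIBBS LAW. Yau's relative-entropy method for the
hard-sphere system on `𝕋³` at `0 < σ ≤ 1/2`, started from the local Gibbs law `λ_N = localGibbsLaw σ a₀ u₀ θ₀ N Φ`
RESTRICTED to a measurable set `S` of initial data (the crux restricts to the speed-cap event),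
`μ_r := lawAt Φ (λ_N|_S) r = (λ_N|_S).map (Φ_r)`. Step (i) of the entropy clock over one window `[s, s + h]` as an
EXACT finite-`N` identity: for a SMOOTH reference `ψ = (b, w, ϑ)` used on the window and a continuous reference
`ψ′ = (b′, w′, ϑ′)` used from `s + h` on,

  `KL(μ_{s+h} ‖ ψ′_N) − KL(μ_s ‖ ψ_N) = − E_{μ_s}[∫₀ʰ G′_ψ(Φ_r z) dr + W^mom_{w/ϑ}(z, h) + W^en_{−1/ϑ}(z, h)]`
  `+ E_{μ_{s+h}}[G_ψ − G_{ψ′}] + λ_N(S) · (log Z_pos(b′) − log Z_pos(b))`,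

where `G_ψ(z) = Σ_i g_ψ(z_i)`, `g_ψ(x, v) = log b(x) − (3/2) log(2πϑ(x)) − |v − w(x)|²/(2ϑ(x))`, `G′_ψ` is its
streaming derivative and `W^mom`, `W^en` are the collisional transfers along the flow. This is the restricted twin
of `EntropyClockDock.windowEntropyBalance_identity` (`S = univ`): the two explicit restricted entropies
`CappedEulerLimit.toReal_klDiv_lawAt_restrict_eq_integral` are subtracted (the `G_λ`-terms and the mass defects
`1 − λ_N(S)` cancel, the log-partition constants combine with the weight `λ_N(S)`); the window term is transported
to `λ_N|_S` (`Φ_{s+h} = Φ_h ∘ Φ_s` on the good set, which carries `λ_N`, hence `λ_N|_S` and `μ_s`) and evaluated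
pathwise by `EntropyClockDock.oneBodySum_flow_sub_eq`; the switch term is transported to `λ_N|_S` at time `s + h`.

Worker file of the lead prover-line-stmt-AtomisticToContinuum-17739-c1-0 (`--supports stmt-AtomisticToContinuum-17739`).

References: H.-T. Yau, *Relative entropy and hydrodynamics of Ginzburg–Landau models*, Lett. Math. Phys. 22
(1991), §2; S. Olla, S. R. S. Varadhan, H.-T. Yau, Comm. Math. Phys. 155 (1993), §3.
-/

noncomputable section

namespace Summit.AtomisticToContinuum.HydrodynamicLimit.Theorems.CappedEulerLimit

open scoped ENNReal NNReal Topology InnerProductSpace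
open MeasureTheory Filter Set InformationTheory
open Literature.Analysis.FluidPDE Literature.MathematicalPhysics.KineticTheory Literature.Analysis.FunctionSpaces
open Summit.AtomisticToContinuum.HydrodynamicLimit.Theorems

/-- **The one-window entropy balance for the RESTRICTED local Gibbs law** (registered stub of line
`registered`, crux `SpeedCapSurgery.CappedEulerLimit`) — step (i) of the entropy clock as an EXACT finite-`N`
identity over one window. For the hard-sphere system on `𝕋³` at `0 < σ ≤ 1/2` started from
`λ_N = localGibbsLaw σ a₀ u₀ θ₀ N Φ` restricted to a measurable set `S` of initial data, a SMOOTH reference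
`ψ = (b, w, ϑ)` (used on `[s, s+h]`) and a continuous reference `ψ′ = (b′, w′, ϑ′)` (used from `s + h` on), all
profiles positive, `s, h ≥ 0`, `μ_r = lawAt Φ (λ_N|_S) r`:
`KL(μ_{s+h} ‖ ψ′_N) − KL(μ_s ‖ ψ_N) = − E_{μ_s}[∫₀ʰ G′_ψ(Φ_r z) dr + W^mom_{w/ϑ}(z,h) + W^en_{−1/ϑ}(z,h)]`
`+ E_{μ_{s+h}}[G_ψ − G_{ψ′}] + λ_N(S) · (log Z_pos(b′) − log Z_pos(b))`: the two explicit restricted entropies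
`toReal_klDiv_lawAt_restrict_eq_integral` subtracted; the window term `∫_S [G_ψ(Φ_s z) − G_ψ(Φ_{s+h} z)] dλ_N`
is transported to `μ_s` (`Φ_{s+h} = Φ_h ∘ Φ_s` on the good set, which carries `λ_N|_S` and `μ_s`) and evaluated
pathwise by `EntropyClockDock.oneBodySum_flow_sub_eq`; the switch term `∫_S (G_ψ − G_{ψ′})(Φ_{s+h} z) dλ_N` is
transported to `μ_{s+h}`. The restricted twin of `EntropyClockDock.windowEntropyBalance_identity`.
[cite: Yau1991, §2] -/
theorem restricted_windowEntropyBalance_identity :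
  ∀ (σ : ℝ), 0 < σ → σ ≤ 1 / 2 →
  ∀ (a₀ θ₀ : T3 → ℝ) (u₀ : T3 → V3), Continuous a₀ → Continuous θ₀ → Continuous u₀ →
    (∀ x, 0 < a₀ x) → (∀ x, 0 < θ₀ x) →
  ∀ (b ϑ : T3 → ℝ) (w : T3 → V3), Literature.Analysis.FunctionSpaces.Torus.IsSmooth b →
    Literature.Analysis.FunctionSpaces.Torus.IsSmooth ϑ → Literature.Analysis.FunctionSpaces.Torus.IsSmooth w →
    (∀ x, 0 < b x) → (∀ x, 0 < ϑ x) →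
  ∀ (b' ϑ' : T3 → ℝ) (w' : T3 → V3), Continuous b' → Continuous ϑ' → Continuous w' →
    (∀ x, 0 < b' x) → (∀ x, 0 < ϑ' x) →
  ∀ (N : ℕ) (Φ : HardSphereFlow (Torus.geometry (Fin 3)) (hsDiameter σ N) (N + 1)) (s h : ℝ), 0 ≤ s → 0 ≤ h →
  ∀ (S : Set (Config (N + 1) (Fin 3) T3)), MeasurableSet S →
    (klDiv (Φ.lawAt ((localGibbsLaw σ a₀ u₀ θ₀ N Φ).restrict S) (s + h)) (localGibbsLaw σ b' w' ϑ' N Φ)).toReal -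
        (klDiv (Φ.lawAt ((localGibbsLaw σ a₀ u₀ θ₀ N Φ).restrict S) s) (localGibbsLaw σ b w ϑ N Φ)).toReal =
      -(∫ z, ((∫ r in (0 : ℝ)..h,
                ((∑ i, Literature.Analysis.FunctionSpaces.Torus.fderiv
                    (fun x => Real.log (b x) - 3 / 2 * Real.log (2 * Real.pi * ϑ x) - ‖w x‖ ^ 2 / (2 * ϑ x))
                    ((Φ.flow r z i).1) ((Φ.flow r z i).2)) +
                  momentumStreaming (fun x => (ϑ x)⁻¹ • w x) (Φ.flow r z) +
                  energyStreaming (fun x => -(ϑ x)⁻¹) (Φ.flow r z))) +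
              Φ.momentumTransfer (fun x => (ϑ x)⁻¹ • w x) z h +
              Φ.energyTransfer (fun x => -(ϑ x)⁻¹) z h)
          ∂(Φ.lawAt ((localGibbsLaw σ a₀ u₀ θ₀ N Φ).restrict S) s)) +
        (∫ z, ((∑ i, (Real.log (b (z i).1) - 3 / 2 * Real.log (2 * Real.pi * ϑ (z i).1) -
                  ‖(z i).2 - w (z i).1‖ ^ 2 / (2 * ϑ (z i).1))) -
              ∑ i, (Real.log (b' (z i).1) - 3 / 2 * Real.log (2 * Real.pi * ϑ' (z i).1) -
                  ‖(z i).2 - w' (z i).1‖ ^ 2 / (2 * ϑ' (z i).1)))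
          ∂(Φ.lawAt ((localGibbsLaw σ a₀ u₀ θ₀ N Φ).restrict S) (s + h))) +
        (localGibbsLaw σ a₀ u₀ θ₀ N Φ S).toReal *
          (Real.log (posPartition b' (hsDiameter σ N) (N + 1)) -
            Real.log (posPartition b (hsDiameter σ N) (N + 1))) := by
  intro σ _hσ hσ2 a₀ θ₀ u₀ ha hθ hu ha0 hθ0 b ϑ w hbs hϑs hws hb0 hϑ0 b' ϑ' w' hb' hϑ' hw' hb'0 hϑ'0
    N Φ s h _hs hh S hS
  obtain ⟨hb, hϑ, hw⟩ : Continuous b ∧ Continuous ϑ ∧ Continuous w :=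
    ⟨hbs.continuous, hϑs.continuous, hws.continuous⟩
  -- the good set carries `λ_N`, hence `λ_N|_S`
  have hgood : ∀ᵐ z ∂((localGibbsLaw σ a₀ u₀ θ₀ N Φ).restrict S), z ∈ Φ.good :=
    ae_restrict_of_ae (EntropyClockDock.ae_mem_good_localGibbsLaw σ a₀ θ₀ u₀ N Φ)
  -- the two explicit restricted entropies and the integrable one-body sums (restricted to `S`)
  have e1 := toReal_klDiv_lawAt_restrict_eq_integral hσ2 ha hθ hu ha0 hθ0 hb' hϑ' hw' hb'0 hϑ'0 N Φ
    (s + h) hS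
  have e2 := toReal_klDiv_lawAt_restrict_eq_integral hσ2 ha hθ hu ha0 hθ0 hb hϑ hw hb0 hϑ0 N Φ s hS
  have hG0 := (EntropyClockDock.integrable_oneBodySum hσ2 ha hθ hu ha0 hθ0 ha hθ hu ha0 hθ0 N Φ).restrict
    (s := S)
  have h1 := (EntropyClockDock.integrable_oneBodySum_flow hσ2 ha hθ hu ha0 hθ0 hb hϑ hw hb0 hϑ0 N Φ
    s).restrict (s := S)
  have h2 := (EntropyClockDock.integrable_oneBodySum_flow hσ2 ha hθ hu ha0 hθ0 hb' hϑ' hw' hb'0 hϑ'0 N Φ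
    (s + h)).restrict (s := S)
  have h3 := (EntropyClockDock.integrable_oneBodySum_flow hσ2 ha hθ hu ha0 hθ0 hb hϑ hw hb0 hϑ0 N Φ
    (s + h)).restrict (s := S)
  -- (a) the window term, transported to `λ_N|_S` and evaluated pathwise on the good set
  have hA : (∫ z, (∫ r in (0 : ℝ)..h,
          ((∑ i, Torus.fderiv
              (fun x => Real.log (b x) - 3 / 2 * Real.log (2 * Real.pi * ϑ x) - ‖w x‖ ^ 2 / (2 * ϑ x))
              ((Φ.flow r z i).1) ((Φ.flow r z i).2)) +
            momentumStreaming (fun x => (ϑ x)⁻¹ • w x) (Φ.flow r z) +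
            energyStreaming (fun x => -(ϑ x)⁻¹) (Φ.flow r z))) +
        Φ.momentumTransfer (fun x => (ϑ x)⁻¹ • w x) z h +
        Φ.energyTransfer (fun x => -(ϑ x)⁻¹) z h
          ∂(Φ.lawAt ((localGibbsLaw σ a₀ u₀ θ₀ N Φ).restrict S) s)) =
      ∫ z in S, ((∑ i, (Real.log (b (Φ.flow (s + h) z i).1) -
            3 / 2 * Real.log (2 * Real.pi * ϑ (Φ.flow (s + h) z i).1) -
            ‖(Φ.flow (s + h) z i).2 - w (Φ.flow (s + h) z i).1‖ ^ 2 / (2 * ϑ (Φ.flow (s + h) z i).1))) -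
          ∑ i, (Real.log (b (Φ.flow s z i).1) - 3 / 2 * Real.log (2 * Real.pi * ϑ (Φ.flow s z i).1) -
            ‖(Φ.flow s z i).2 - w (Φ.flow s z i).1‖ ^ 2 / (2 * ϑ (Φ.flow s z i).1)))
        ∂(localGibbsLaw σ a₀ u₀ θ₀ N Φ) := by
    have hgood' : ∀ᵐ y ∂(Φ.lawAt ((localGibbsLaw σ a₀ u₀ θ₀ N Φ).restrict S) s), y ∈ Φ.good := by
      rw [HardSphereFlow.lawAt_eq]
      exact (ae_map_iff (Φ.measurable_flow s).aemeasurable Φ.measurableSet_good).2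
        (hgood.mono fun z hz => Φ.mapsTo_good s hz)
    calc _ = ∫ y, ((∑ i, (Real.log (b (Φ.flow h y i).1) - 3 / 2 * Real.log (2 * Real.pi * ϑ (Φ.flow h y i).1) -
              ‖(Φ.flow h y i).2 - w (Φ.flow h y i).1‖ ^ 2 / (2 * ϑ (Φ.flow h y i).1))) -
            ∑ i, (Real.log (b (y i).1) - 3 / 2 * Real.log (2 * Real.pi * ϑ (y i).1) -
              ‖(y i).2 - w (y i).1‖ ^ 2 / (2 * ϑ (y i).1)))
          ∂(Φ.lawAt ((localGibbsLaw σ a₀ u₀ θ₀ N Φ).restrict S) s) := by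
          refine integral_congr_ae ?_
          filter_upwards [hgood'] with y hy
          exact (EntropyClockDock.oneBodySum_flow_sub_eq Φ hbs hϑs hws hb0 hϑ0 hy hh).symm
      _ = ∫ z in S, ((∑ i, (Real.log (b (Φ.flow h (Φ.flow s z) i).1) -
              3 / 2 * Real.log (2 * Real.pi * ϑ (Φ.flow h (Φ.flow s z) i).1) -
              ‖(Φ.flow h (Φ.flow s z) i).2 - w (Φ.flow h (Φ.flow s z) i).1‖ ^ 2 /
                (2 * ϑ (Φ.flow h (Φ.flow s z) i).1))) -
            ∑ i, (Real.log (b (Φ.flow s z i).1) - 3 / 2 * Real.log (2 * Real.pi * ϑ (Φ.flow s z i).1) -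
              ‖(Φ.flow s z i).2 - w (Φ.flow s z i).1‖ ^ 2 / (2 * ϑ (Φ.flow s z i).1)))
          ∂(localGibbsLaw σ a₀ u₀ θ₀ N Φ) := by
          rw [HardSphereFlow.lawAt_eq]
          exact integral_map (Φ.measurable_flow s).aemeasurable
            (((EntropyClockDock.measurable_oneBodySum hb hϑ hw).comp (Φ.measurable_flow h)).sub
              (EntropyClockDock.measurable_oneBodySum hb hϑ hw)).aestronglyMeasurable
      _ = _ := by
          refine integral_congr_ae ?_
          filter_upwards [hgood] with z hz
          rw [add_comm s h, Φ.flow_add h s z hz]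
  -- (b) the reference switch at time `s + h`, transported to `λ_N|_S`
  have hB : (∫ z, ((∑ i, (Real.log (b (z i).1) - 3 / 2 * Real.log (2 * Real.pi * ϑ (z i).1) -
          ‖(z i).2 - w (z i).1‖ ^ 2 / (2 * ϑ (z i).1))) -
        ∑ i, (Real.log (b' (z i).1) - 3 / 2 * Real.log (2 * Real.pi * ϑ' (z i).1) -
          ‖(z i).2 - w' (z i).1‖ ^ 2 / (2 * ϑ' (z i).1)))
      ∂(Φ.lawAt ((localGibbsLaw σ a₀ u₀ θ₀ N Φ).restrict S) (s + h))) =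
      ∫ z in S, ((∑ i, (Real.log (b (Φ.flow (s + h) z i).1) -
            3 / 2 * Real.log (2 * Real.pi * ϑ (Φ.flow (s + h) z i).1) -
            ‖(Φ.flow (s + h) z i).2 - w (Φ.flow (s + h) z i).1‖ ^ 2 / (2 * ϑ (Φ.flow (s + h) z i).1))) -
          ∑ i, (Real.log (b' (Φ.flow (s + h) z i).1) -
            3 / 2 * Real.log (2 * Real.pi * ϑ' (Φ.flow (s + h) z i).1) -
            ‖(Φ.flow (s + h) z i).2 - w' (Φ.flow (s + h) z i).1‖ ^ 2 / (2 * ϑ' (Φ.flow (s + h) z i).1)))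
        ∂(localGibbsLaw σ a₀ u₀ θ₀ N Φ) := by
    rw [HardSphereFlow.lawAt_eq]
    exact integral_map (Φ.measurable_flow _).aemeasurable
      ((EntropyClockDock.measurable_oneBodySum hb hϑ hw).sub
        (EntropyClockDock.measurable_oneBodySum hb' hϑ' hw')).aestronglyMeasurable
  rw [e1, e2, hA, hB, integral_sub hG0 h2, integral_sub hG0 h1, integral_sub h3 h1, integral_sub h3 h2]
  ring

end Summit.AtomisticToContinuum.HydrodynamicLimit.Theorems.CappedEulerLimit

end
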